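import Summits.QuantumFields.QCD.Theses.AnomalyRigidity

/-!
# Stub `stub_anomalyGermVanishes` of line `lee-yang-mass-handover`
(crux `Summit.QuantumFields.QCD.Theses.HeatSlicedQuarks.RobustYangMillsHandover`,
item stmt-QuantumFields-8892)

**The Euclidean Coleman–Grossman germ lemma** — item stmt-QuantumFields-16262
`Summit.QuantumFields.QCD.Theses.AnomalyRigidity.AnomalyGermVanishes` of route AnomalyRigidity,
verbatim.  Pure finite-dimensional real/complex analysis on `(Fin 4 → ℝ) × (Fin 4 → ℝ)`
(sup norms, `k.1 = p`, `k.2 = q`).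

Proof.  Fix `m ∈ (0, m₁]`.
* (germ of `Γ_m`)  Each component `k ↦ Γ m k.1 k.2 μ ν λ` is differentiable at `0` with
  derivative `ℓ`; transversality in `p` says `∑ μ p_μ Γ_{μνλ}(k) = o(‖k‖²)`, so the
  linear-plus-quadratic part `∑ μ p_μ (Γ_{μνλ}(0) + ℓ_{μνλ} k)` is `o(‖k‖²)`; restricted to a ray
  `k = t • k₀` this reads `t A + t² Q = o(t²)` in `ℝ`, forcing `A = Q = 0` (`germ_linQuad_zero`).
  With `p = e_μ` this gives `Γ(0) = 0` and `ℓ(e_μ, q) = 0`, hence `ℓ(0, q) = 0`; transversality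
  in `q` gives symmetrically `ℓ(p, 0) = 0`, so `ℓ = 0` and every component of `Γ_m` is `o(‖k‖)`
  (`germ_component_isLittleO`).  Pseudo-covariance is never used.
* (the bilinear form)  Then `(p+q)·Γ_m = o(‖k‖²)`, so the Ward identity says
  `W(k) := κ m Γ^P_m(p,q) + c det[e₀,e₁,p,q] = o(‖k‖²)`; restricting to `(p,0)`, `(0,q)`, `(0,0)`
  (where the determinant has a zero row) and subtracting, the mixed second difference of `Γ^P_m`
  replaces `Γ^P_m`, and the bounded germ `B` turns `W` into the bilinear form
  `κ m ∑ B_{αβ} p_α q_β + c det[e₀,e₁,p,q] = o(‖k‖²)`.  On the ray through `(e₂, e₃)` this is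
  `t² (κ m B₂₃ + c) = o(t²)`, so `κ m B₂₃ + c = 0` and `‖c‖ ≤ κ K m` (`germ_ward_coefficient`).
* (`m → 0`)  `‖c‖ ≤ κ K m` for every `m ∈ (0, m₁]` forces `c = 0`.

Mathlib only (asymptotics, `fderiv`, `Matrix.det`, `Fin 4` sums); no project definitions besides
the item it proves.
-/

namespace Summit.QuantumFields.QCD.Cruxes.RobustYangMillsHandover.LeeYangMassHandover

open Asymptotics Filter Topology
open Summit.QuantumFields.QCD.Theses.AnomalyRigidity

/-! ## Rays: `o(t²)` kills linear and quadratic coefficients -/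

/-- If `t ↦ t a` is `O(t²)` at `0` in `ℝ` then `a = 0`. [folklore] -/
private theorem germ_coeff_zero_of_isBigO_sq {a : ℂ}
    (h : (fun t : ℝ => (t : ℂ) * a) =O[𝓝 0] fun t : ℝ => t ^ 2) : a = 0 := by
  by_contra ha
  have ha' : 0 < ‖a‖ := norm_pos_iff.mpr ha
  obtain ⟨C, hC, hCb⟩ := h.exists_pos
  obtain ⟨δ, hδ, hδb⟩ := Metric.eventually_nhds_iff.mp hCb.bound
  set t : ℝ := min (δ / 2) (‖a‖ / (2 * C)) with ht
  have htpos : 0 < t := lt_min (by linarith) (by positivity)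
  have htδ : dist t 0 < δ := by
    rw [dist_zero_right, Real.norm_of_nonneg htpos.le]
    exact (min_le_left _ _).trans_lt (by linarith)
  have key := hδb htδ
  rw [norm_mul, Complex.norm_real, Real.norm_of_nonneg htpos.le, norm_pow,
    Real.norm_of_nonneg htpos.le] at key
  have h1 : ‖a‖ ≤ C * t := by nlinarith
  have h2 : C * t ≤ C * (‖a‖ / (2 * C)) := mul_le_mul_of_nonneg_left (min_le_right _ _) hC.le
  have h3 : C * (‖a‖ / (2 * C)) = ‖a‖ / 2 := by field_simp
  linarith

/-- If `t ↦ t² b` is `o(t²)` at `0` in `ℝ` then `b = 0`. [folklore] -/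
private theorem germ_coeff_zero_of_isLittleO_sq {b : ℂ}
    (h : (fun t : ℝ => (t : ℂ) ^ 2 * b) =o[𝓝 0] fun t : ℝ => t ^ 2) : b = 0 := by
  by_contra hb
  have hb' : 0 < ‖b‖ := norm_pos_iff.mpr hb
  obtain ⟨δ, hδ, hδb⟩ := Metric.eventually_nhds_iff.mp (h.def (half_pos hb'))
  have htδ : dist (δ / 2) 0 < δ := by
    rw [dist_zero_right, Real.norm_of_nonneg (by linarith)]
    linarith
  have key := hδb htδ
  rw [norm_mul, norm_pow, Complex.norm_real, norm_pow, Real.norm_of_nonneg (by linarith)] at key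
  have hp : 0 < (δ / 2) ^ 2 := by positivity
  nlinarith

/-- If `t ↦ t a + t² b` is `o(t²)` at `0` in `ℝ` then `a = 0` and `b = 0`. [folklore] -/
private theorem germ_linQuad_zero {a b : ℂ}
    (h : (fun t : ℝ => (t : ℂ) * a + (t : ℂ) ^ 2 * b) =o[𝓝 0] fun t : ℝ => t ^ 2) :
    a = 0 ∧ b = 0 := by
  have hb : (fun t : ℝ => (t : ℂ) ^ 2 * b) =O[𝓝 0] fun t : ℝ => t ^ 2 := by
    refine IsBigO.of_bound ‖b‖ (Filter.Eventually.of_forall fun t => ?_)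
    rw [norm_mul, norm_pow, Complex.norm_real, norm_pow, mul_comm]
  have ha : a = 0 := by
    refine germ_coeff_zero_of_isBigO_sq ((h.isBigO.sub hb).congr_left fun t => ?_)
    ring
  refine ⟨ha, germ_coeff_zero_of_isLittleO_sq (h.congr_left fun t => ?_)⟩
  rw [ha, mul_zero, zero_add]

/-- Restriction of an `o(‖k‖²)` germ to the ray `t ↦ t • k₀` is `o(t²)`. [folklore] -/
private theorem germ_ray_isLittleO {E : Type*} [NormedAddCommGroup E] [NormedSpace ℝ E]
    {G : E → ℂ} (hG : G =o[𝓝 0] fun k => ‖k‖ ^ 2) (k₀ : E) :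
    (fun t : ℝ => G (t • k₀)) =o[𝓝 0] fun t : ℝ => t ^ 2 := by
  have hc : Continuous fun t : ℝ => t • k₀ := continuous_id.smul continuous_const
  have hT : Tendsto (fun t : ℝ => t • k₀) (𝓝 0) (𝓝 0) := by simpa using hc.tendsto 0
  refine (hG.comp_tendsto hT).trans_isBigO ?_
  refine IsBigO.of_bound (‖k₀‖ ^ 2) (Filter.Eventually.of_forall fun t => ?_)
  simp only [Function.comp_apply, norm_smul, norm_pow, Real.norm_eq_abs, abs_mul, abs_abs,
    abs_norm]
  exact le_of_eq (by ring)

/-- Pre-composition of an `o(‖k‖²)` germ with a norm-non-increasing self-map is `o(‖k‖²)`.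
[folklore] -/
private theorem germ_isLittleO_comp {E : Type*} [NormedAddCommGroup E] {G : E → ℂ}
    (hG : G =o[𝓝 0] fun k => ‖k‖ ^ 2) {P : E → E} (hP : ∀ k, ‖P k‖ ≤ ‖k‖) :
    (fun k => G (P k)) =o[𝓝 0] fun k => ‖k‖ ^ 2 := by
  have hT : Tendsto P (𝓝 0) (𝓝 0) := squeeze_zero_norm hP tendsto_norm_zero
  refine (hG.comp_tendsto hT).trans_isBigO ?_
  refine IsBigO.of_bound 1 (Filter.Eventually.of_forall fun k => ?_)
  simp only [Function.comp_apply, norm_pow, norm_norm, one_mul]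
  exact pow_le_pow_left₀ (norm_nonneg _) (hP k) 2

/-- An `o(‖k‖²)` germ vanishes at the base point. [folklore] -/
private theorem germ_eq_zero_of_isLittleO {E : Type*} [NormedAddCommGroup E] {G : E → ℂ}
    (hG : G =o[𝓝 0] fun k => ‖k‖ ^ 2) : G 0 = 0 := by
  obtain ⟨C, hC⟩ := hG.isBigO.bound
  have h0 := hC.self_of_nhds
  simpa using h0

/-! ## Step 1: transversality and differentiability kill the germ of `Γ_m` -/

/-- Contraction with a unit coordinate vector picks one component. [folklore] -/
private theorem germ_sum_single_mul (μ : Fin 4) (g : Fin 4 → ℂ) :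
    ∑ i, (((Pi.single μ (1 : ℝ) : Fin 4 → ℝ) i : ℝ) : ℂ) * g i = g μ := by
  rw [Finset.sum_eq_single μ (fun i _ hi => by simp [hi]) (fun h => absurd (Finset.mem_univ _) h)]
  simp

/-- **Ray extraction.**  If the components `g i` are differentiable at `0` with derivatives `L i`
and the contraction `∑ i a(k)_i g_i(k)` with a homogeneous coefficient `a` bounded by the norm is
`o(‖k‖²)`, then along every ray both the constant and the linear Taylor coefficients of the
contraction vanish: `∑ i a(k₀)_i g_i(0) = 0` and `∑ i a(k₀)_i L_i k₀ = 0`. [folklore] -/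
private theorem germ_stage_one {E : Type*} [NormedAddCommGroup E] [NormedSpace ℝ E]
    {a : E → (Fin 4 → ℝ)} (ha_smul : ∀ (t : ℝ) (k : E), a (t • k) = t • a k)
    (ha_le : ∀ (k : E) (i : Fin 4), ‖a k i‖ ≤ ‖k‖)
    {g : Fin 4 → E → ℂ} {L : Fin 4 → E →L[ℝ] ℂ} (hL : ∀ i, HasFDerivAt (g i) (L i) 0)
    (hT : (fun k => ∑ i, ((a k i : ℝ) : ℂ) * g i k) =o[𝓝 0] fun k => ‖k‖ ^ 2) (k₀ : E) :
    (∑ i, ((a k₀ i : ℝ) : ℂ) * g i 0 = 0) ∧ (∑ i, ((a k₀ i : ℝ) : ℂ) * L i k₀ = 0) := by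
  -- Taylor remainders are `o(‖k‖)`
  have hR : ∀ i, (fun k => g i k - g i 0 - L i k) =o[𝓝 0] fun k => ‖k‖ := fun i => by
    have h := (hL i).isLittleO
    simp only [sub_zero] at h
    exact h.norm_right
  -- coefficients are `O(‖k‖)`
  have hA : ∀ i, (fun k => ((a k i : ℝ) : ℂ)) =O[𝓝 0] fun k => ‖k‖ := fun i => by
    refine IsBigO.of_bound 1 (Filter.Eventually.of_forall fun k => ?_)
    rw [Complex.norm_real, norm_norm, one_mul]
    exact ha_le k i
  -- so the remainder contraction is `o(‖k‖²)`, and the polynomial part as well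
  have hE : (fun k => ∑ i, ((a k i : ℝ) : ℂ) * (g i k - g i 0 - L i k)) =o[𝓝 0]
      fun k => ‖k‖ ^ 2 :=
    IsLittleO.sum fun i _ => ((hA i).mul_isLittleO (hR i)).congr_right fun k => (sq ‖k‖).symm
  have hG : (fun k => ∑ i, ((a k i : ℝ) : ℂ) * (g i 0 + L i k)) =o[𝓝 0] fun k => ‖k‖ ^ 2 := by
    refine (hT.sub hE).congr_left fun k => ?_
    rw [← Finset.sum_sub_distrib]
    exact Finset.sum_congr rfl fun i _ => by ring
  -- restrict to the ray through `k₀`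
  refine germ_linQuad_zero ((germ_ray_isLittleO hG k₀).congr_left fun t => ?_)
  simp only [map_smul, ha_smul, Pi.smul_apply, smul_eq_mul, Complex.real_smul, Complex.ofReal_mul,
    Finset.mul_sum]
  rw [← Finset.sum_add_distrib]
  exact Finset.sum_congr rfl fun i _ => by ring

/-- **The germ of `Γ_m` vanishes to first order.**  Bi-transversality up to `o(‖k‖²)` and
differentiability at `0` force `Γ(0) = 0` and `fderiv Γ 0 = 0` for every component, i.e. every
component is `o(‖k‖)`. [folklore] -/
private theorem germ_component_isLittleO
    {f : Fin 4 → Fin 4 → Fin 4 → (Fin 4 → ℝ) × (Fin 4 → ℝ) → ℂ}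
    (hT1 : ∀ ν la, (fun k : (Fin 4 → ℝ) × (Fin 4 → ℝ) =>
      ∑ μ, ((k.1 μ : ℝ) : ℂ) * f μ ν la k) =o[𝓝 0] fun k => ‖k‖ ^ 2)
    (hT2 : ∀ μ la, (fun k : (Fin 4 → ℝ) × (Fin 4 → ℝ) =>
      ∑ ν, ((k.2 ν : ℝ) : ℂ) * f μ ν la k) =o[𝓝 0] fun k => ‖k‖ ^ 2)
    (hD : ∀ μ ν la, DifferentiableAt ℝ (f μ ν la) 0) (μ ν la : Fin 4) :
    f μ ν la =o[𝓝 0] fun k => ‖k‖ := by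
  obtain ⟨L, hL⟩ : ∃ L : Fin 4 → Fin 4 → Fin 4 → (Fin 4 → ℝ) × (Fin 4 → ℝ) →L[ℝ] ℂ,
      ∀ μ ν la, HasFDerivAt (f μ ν la) (L μ ν la) 0 :=
    ⟨fun μ ν la => fderiv ℝ (f μ ν la) 0, fun μ ν la => (hD μ ν la).hasFDerivAt⟩
  have h1 : ∀ ν la (p q : Fin 4 → ℝ), (∑ μ, ((p μ : ℝ) : ℂ) * f μ ν la 0 = 0) ∧
      (∑ μ, ((p μ : ℝ) : ℂ) * L μ ν la (p, q) = 0) := fun ν la p q =>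
    germ_stage_one (a := Prod.fst) (fun _ _ => rfl)
      (fun k i => (norm_le_pi_norm k.1 i).trans (norm_fst_le k)) (fun μ => hL μ ν la) (hT1 ν la)
      (p, q)
  have h2 : ∀ μ la (p q : Fin 4 → ℝ), (∑ ν, ((q ν : ℝ) : ℂ) * f μ ν la 0 = 0) ∧
      (∑ ν, ((q ν : ℝ) : ℂ) * L μ ν la (p, q) = 0) := fun μ la p q =>
    germ_stage_one (a := Prod.snd) (fun _ _ => rfl)
      (fun k i => (norm_le_pi_norm k.2 i).trans (norm_snd_le k)) (fun ν => hL μ ν la) (hT2 μ la)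
      (p, q)
  -- the value at zero vanishes
  have hf0 : ∀ μ ν la, f μ ν la 0 = 0 := by
    intro μ ν la
    have h := (h1 ν la (Pi.single μ 1) 0).1
    rwa [germ_sum_single_mul] at h
  -- the derivative vanishes on `(0, q)` ...
  have hL0q : ∀ μ ν la (q : Fin 4 → ℝ), L μ ν la (0, q) = 0 := by
    intro μ ν la q
    have he : ∀ q' : Fin 4 → ℝ, L μ ν la (Pi.single μ 1, q') = 0 := fun q' => by
      have h := (h1 ν la (Pi.single μ 1) q').2
      rwa [germ_sum_single_mul] at h
    have hsplit : ((0 : Fin 4 → ℝ), q) = ((Pi.single μ 1 : Fin 4 → ℝ), q) - (Pi.single μ 1, 0) := by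
      simp
    rw [hsplit, map_sub, he, he, sub_zero]
  -- ... and on `(p, 0)`, hence everywhere
  have hLp0 : ∀ μ ν la (p : Fin 4 → ℝ), L μ ν la (p, 0) = 0 := by
    intro μ ν la p
    have he : L μ ν la (p, Pi.single ν 1) = 0 := by
      have h := (h2 μ la p (Pi.single ν 1)).2
      rwa [germ_sum_single_mul] at h
    have hsplit : (p, (0 : Fin 4 → ℝ)) = (p, (Pi.single ν 1 : Fin 4 → ℝ)) - (0, Pi.single ν 1) := by
      simp
    rw [hsplit, map_sub, he, hL0q, sub_zero]
  have hLz : ∀ μ ν la (k : (Fin 4 → ℝ) × (Fin 4 → ℝ)), L μ ν la k = 0 := by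
    intro μ ν la k
    have hsplit : k = (k.1, 0) + (0, k.2) := by simp
    rw [hsplit, map_add, hLp0, hL0q, add_zero]
  -- conclude from the Taylor expansion
  have hR := (hL μ ν la).isLittleO
  simp only [sub_zero] at hR
  refine hR.norm_right.congr_left fun k => ?_
  rw [hf0, hLz, sub_zero, sub_zero]

/-! ## Step 2: the Ward identity and the bounded germ isolate the anomaly coefficient -/

/-- The determinant `det[e₀, e₁, p, 0]` vanishes (zero row). [folklore] -/
private theorem germ_det_row3_zero (p : Fin 4 → ℝ) :
    (Matrix.of ![(Pi.single 0 1 : Fin 4 → ℝ), Pi.single 1 1, p, 0]).det = 0 :=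
  Matrix.det_eq_zero_of_row_eq_zero 3 fun j => by simp

/-- The determinant `det[e₀, e₁, 0, q]` vanishes (zero row). [folklore] -/
private theorem germ_det_row2_zero (q : Fin 4 → ℝ) :
    (Matrix.of ![(Pi.single 0 1 : Fin 4 → ℝ), Pi.single 1 1, 0, q]).det = 0 :=
  Matrix.det_eq_zero_of_row_eq_zero 2 fun j => by simp

/-- The test determinant `det[e₀, e₁, t e₂, t e₃] = t²` (a diagonal matrix). [folklore] -/
private theorem germ_det_test (t : ℝ) :
    (Matrix.of ![(Pi.single 0 1 : Fin 4 → ℝ), Pi.single 1 1, t • Pi.single 2 1,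
      t • Pi.single 3 1]).det = t ^ 2 := by
  have h : Matrix.of ![(Pi.single 0 1 : Fin 4 → ℝ), Pi.single 1 1, t • Pi.single 2 1,
      t • Pi.single 3 1] = Matrix.diagonal ![1, 1, t, t] := by
    ext i j
    fin_cases i <;> fin_cases j <;> simp
  rw [h, Matrix.det_diagonal, Fin.prod_univ_four]
  simp only [Matrix.cons_val_zero, Matrix.cons_val_one, Matrix.cons_val]
  ring

/-- The test bilinear form `∑ B_{αβ} (t e₂)_α (t e₃)_β = t² B₂₃`. [folklore] -/
private theorem germ_sum_test (B : Fin 4 → Fin 4 → ℂ) (t : ℝ) :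
    ∑ al, ∑ be, B al be * (((t • (Pi.single 2 1 : Fin 4 → ℝ)) al : ℝ) : ℂ) *
      (((t • (Pi.single 3 1 : Fin 4 → ℝ)) be : ℝ) : ℂ) = (t : ℂ) ^ 2 * B 2 3 := by
  simp [Fin.sum_univ_four]
  ring

/-- **The anomaly coefficient is a germ coefficient.**  If every component `Γ_{01λ}` is `o(‖k‖)`,
the subtracted Ward identity holds up to `o(‖k‖²)` with coefficient `κm` and anomaly `c`, and the
mixed second difference of `Γ^P` has the bilinear germ `B`, then `κm B₂₃ + c = 0`. [folklore] -/
private theorem germ_ward_coefficient {Γ01 : Fin 4 → (Fin 4 → ℝ) × (Fin 4 → ℝ) → ℂ}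
    (hΓ : ∀ la, Γ01 la =o[𝓝 0] fun k => ‖k‖)
    {GP : (Fin 4 → ℝ) → (Fin 4 → ℝ) → ℂ} {c κm : ℂ} {B : Fin 4 → Fin 4 → ℂ}
    (hW : (fun k : (Fin 4 → ℝ) × (Fin 4 → ℝ) =>
      (∑ la, ((k.1 la + k.2 la : ℝ) : ℂ) * Γ01 la k) - κm * GP k.1 k.2 -
      c * ((Matrix.det (Matrix.of ![Pi.single 0 1, Pi.single 1 1, k.1, k.2]) : ℝ) : ℂ)) =o[𝓝 0]
      fun k => ‖k‖ ^ 2)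
    (hB : (fun k : (Fin 4 → ℝ) × (Fin 4 → ℝ) => GP k.1 k.2 - GP k.1 0 - GP 0 k.2 + GP 0 0 -
      ∑ al, ∑ be, B al be * ((k.1 al : ℝ) : ℂ) * ((k.2 be : ℝ) : ℂ)) =o[𝓝 0] fun k => ‖k‖ ^ 2) :
    κm * B 2 3 + c = 0 := by
  -- the Ward left-hand side `(p+q)·Γ` is `o(‖k‖²)`
  have hS : (fun k : (Fin 4 → ℝ) × (Fin 4 → ℝ) =>
      ∑ la, ((k.1 la + k.2 la : ℝ) : ℂ) * Γ01 la k) =o[𝓝 0] fun k => ‖k‖ ^ 2 := by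
    refine IsLittleO.sum fun la _ => ?_
    have hA : (fun k : (Fin 4 → ℝ) × (Fin 4 → ℝ) => ((k.1 la + k.2 la : ℝ) : ℂ)) =O[𝓝 0]
        fun k => ‖k‖ := by
      refine IsBigO.of_bound 2 (Filter.Eventually.of_forall fun k => ?_)
      rw [Complex.norm_real, norm_norm]
      calc ‖k.1 la + k.2 la‖ ≤ ‖k.1 la‖ + ‖k.2 la‖ := norm_add_le _ _
        _ ≤ ‖k‖ + ‖k‖ := add_le_add ((norm_le_pi_norm k.1 la).trans (norm_fst_le k))
            ((norm_le_pi_norm k.2 la).trans (norm_snd_le k))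
        _ = 2 * ‖k‖ := by ring
    exact (hA.mul_isLittleO (hΓ la)).congr_right fun k => (sq ‖k‖).symm
  -- hence `W k := κm Γ^P(p,q) + c det[e₀,e₁,p,q]` is `o(‖k‖²)`
  have hW' : (fun k : (Fin 4 → ℝ) × (Fin 4 → ℝ) => κm * GP k.1 k.2 +
      c * ((Matrix.det (Matrix.of ![Pi.single 0 1, Pi.single 1 1, k.1, k.2]) : ℝ) : ℂ)) =o[𝓝 0]
      fun k => ‖k‖ ^ 2 :=
    (hS.sub hW).congr_left fun k => by ring
  -- restrictions to `(p, 0)`, `(0, q)` and the value at `(0, 0)`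
  have hW1 : (fun k : (Fin 4 → ℝ) × (Fin 4 → ℝ) => κm * GP k.1 0) =o[𝓝 0] fun k => ‖k‖ ^ 2 := by
    refine (germ_isLittleO_comp hW' (P := fun k => (k.1, 0)) fun k => ?_).congr_left fun k => ?_
    · rw [Prod.norm_mk, norm_zero, max_eq_left (norm_nonneg _)]
      exact norm_fst_le k
    · simp only [germ_det_row3_zero, Complex.ofReal_zero, mul_zero, add_zero]
  have hW2 : (fun k : (Fin 4 → ℝ) × (Fin 4 → ℝ) => κm * GP 0 k.2) =o[𝓝 0] fun k => ‖k‖ ^ 2 := by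
    refine (germ_isLittleO_comp hW' (P := fun k => (0, k.2)) fun k => ?_).congr_left fun k => ?_
    · rw [Prod.norm_mk, norm_zero, max_eq_right (norm_nonneg _)]
      exact norm_snd_le k
    · simp only [germ_det_row2_zero, Complex.ofReal_zero, mul_zero, add_zero]
  have hW0 : κm * GP 0 0 = 0 := by
    have h := germ_eq_zero_of_isLittleO hW1
    simpa using h
  -- the bilinear form `κm B + c det` is `o(‖k‖²)`
  have hM : (fun k : (Fin 4 → ℝ) × (Fin 4 → ℝ) =>
      κm * (∑ al, ∑ be, B al be * ((k.1 al : ℝ) : ℂ) * ((k.2 be : ℝ) : ℂ)) +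
      c * ((Matrix.det (Matrix.of ![Pi.single 0 1, Pi.single 1 1, k.1, k.2]) : ℝ) : ℂ)) =o[𝓝 0]
      fun k => ‖k‖ ^ 2 := by
    refine (((hW'.sub hW1).sub hW2).sub (hB.const_mul_left κm)).congr_left fun k => ?_
    linear_combination -hW0
  -- evaluate on the ray through `(e₂, e₃)`
  refine germ_coeff_zero_of_isLittleO_sq ((germ_ray_isLittleO hM
    ((Pi.single 2 1 : Fin 4 → ℝ), (Pi.single 3 1 : Fin 4 → ℝ))).congr_left fun t => ?_)
  simp only [Prod.smul_mk]
  rw [germ_sum_test, germ_det_test]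
  push_cast
  ring

/-! ## Step 3: `‖c‖ ≤ κ K m` for all small `m` forces `c = 0` -/

/-- A real number bounded by `A m` for every `m ∈ (0, m₁]` is non-positive. [folklore] -/
private theorem germ_nonpos_of_le_mul {x A m₁ : ℝ} (hm₁ : 0 < m₁)
    (h : ∀ m : ℝ, 0 < m → m ≤ m₁ → x ≤ A * m) : x ≤ 0 := by
  by_contra hx
  push Not at hx
  rcases le_or_gt A 0 with hA | hA
  · have h1 := h m₁ hm₁ le_rfl
    nlinarith
  · have hmpos : 0 < min m₁ (x / (2 * A)) := lt_min hm₁ (by positivity)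
    have h1 := h _ hmpos (min_le_left _ _)
    have h2 : A * min m₁ (x / (2 * A)) ≤ A * (x / (2 * A)) :=
      mul_le_mul_of_nonneg_left (min_le_right _ _) hA.le
    have h3 : A * (x / (2 * A)) = x / 2 := by field_simp
    linarith

/-- **stub_anomalyGermVanishes — item stmt-QuantumFields-16262 `AnomalyGermVanishes` BY NAME**
(registered stub of line `lee-yang-mass-handover`; the Euclidean Coleman–Grossman germ lemma):
for families `Γ_m`, `Γ^P_m` (`m ∈ (0, m₁]`), `c ∈ ℂ`, `κ ≥ 0`, `K`, if for every `m` the tensor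
function `Γ_m` is bi-transverse up to `o(‖k‖²)`, differentiable at `0`, satisfies the subtracted
Ward identity `(p+q)·Γ_m − κ m Γ^P_m − c det[e_μ,e_ν,p,q] = o(‖k‖²)`, and `Γ^P_m` has a mixed
germ `B_m` with `‖B_m‖ ≤ K`, then `c = 0`.  Proof: transversality + differentiability make every
component of `Γ_m` an `o(‖k‖)` (`germ_component_isLittleO`; the pseudo-covariance hypothesis is
not needed), the Ward identity then exhibits `κ m B_m + c det` as an `o(‖k‖²)` bilinear form,
whence `κ m B_{m,23} + c = 0` (`germ_ward_coefficient`) and `‖c‖ ≤ κ K m → 0` — the Euclidean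
germ form of the Coleman–Grossman (1982) anomaly-rigidity argument. [folklore] -/
theorem stub_anomalyGermVanishes : AnomalyGermVanishes := by
  intro Γ ΓP c κ K m₁
  dsimp only
  intro hm₁ hκ hall
  -- the bound `‖c‖ ≤ κ K m` for every admissible `m`
  have key : ∀ m : ℝ, 0 < m → m ≤ m₁ → ‖c‖ ≤ κ * K * m := by
    intro m hm hm1
    obtain ⟨-, hT1, hT2, hD, hWd, hG⟩ := hall m hm hm1
    obtain ⟨B, hBK, hB⟩ := hG 0 1
    have hΓ : ∀ μ ν la, (fun k : (Fin 4 → ℝ) × (Fin 4 → ℝ) => Γ m k.1 k.2 μ ν la) =o[𝓝 0]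
        fun k => ‖k‖ :=
      germ_component_isLittleO (f := fun μ ν la k => Γ m k.1 k.2 μ ν la) hT1 hT2 hD
    have h2 : ((κ * m : ℝ) : ℂ) * B 2 3 + c = 0 :=
      germ_ward_coefficient (GP := fun p q => ΓP m p q 0 1) (fun la => hΓ 0 1 la) (hWd 0 1) hB
    have hc : c = -(((κ * m : ℝ) : ℂ) * B 2 3) := by linear_combination h2
    rw [hc, norm_neg, norm_mul, Complex.norm_real, Real.norm_of_nonneg (mul_nonneg hκ hm.le)]
    calc κ * m * ‖B 2 3‖ ≤ κ * m * K := mul_le_mul_of_nonneg_left (hBK 2 3) (mul_nonneg hκ hm.le)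
      _ = κ * K * m := by ring
  -- let `m → 0`
  exact norm_le_zero_iff.mp (germ_nonpos_of_le_mul hm₁ key)

end Summit.QuantumFields.QCD.Cruxes.RobustYangMillsHandover.LeeYangMassHandover
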